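import Literature.NumberTheory.EllipticCurves.MuThreeTorsorClass
import Literature.NumberTheory.EllipticCurves.MordellCurveThreeDescentKernel
import Literature.NumberTheory.EllipticCurves.ShaIsogeny
import Literature.NumberTheory.GaloisRepresentations.GaloisCohomologyKummerProofs
import HarnessLib

/-!
# The image of `a ↦ [C_a]` is the kernel of `f_*` on `H¹(K, W)` for any equivariant surjection `f`
# with kernel in `{O, ±T}` (Silverman, *AEC*, Thm. X.4.2 (a) at `H¹(K, E)`, `μ₃`-kernel case)

Topic `NumberTheory/EllipticCurves`. Sequel of `MuThreeTorsorClass` (the torsor classes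
`𝒯.torsorClass ha ∈ H¹(K, W)` of a `μ₃`-kernel datum `𝒯 : MuThreeKernel W`, `a ∈ K*`) and
generalisation of the tree's `MordellCurveThreeDescentImage` §3 from the Mordell datum to an arbitrary
`μ₃`-kernel datum; the proofs are those of the template verbatim. Everything here is proved; no
definitions, no named facts. Over an arbitrary field `K` of characteristic `0`:

* `galH1Map_torsorClass_eq_zero` — `f_* [C_a] = 0` as soon as `f(T) = O`.
* **The image theorem** `exists_torsorClass_eq_of_galH1Map_eq_zero`: for any `Γ_K`-equivariant
  homomorphism `f : W(K̄) → W'(K̄)` which is ONTO and whose kernel is contained in `{O, ±T}` (a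
  `3`-isogeny with kernel `⟨T⟩`, its twists by automorphisms, the abstract dual of an isogeny with
  `K`-rational kernel, …), every class of `H¹(K, W)` killed by `f_*` is a torsor class `[C_a]`:
  `ker f_* ⊆ im [C_·]` (Silverman X.4.2 (a): `H¹(G, E[φ]) ↠ WC(E/K)[φ]`, with `H¹(K, μ₃) = K*/K*³` made
  explicit by Hilbert 90 for locally constant cocycles,
  `absoluteGaloisGroup.exists_eq_smul_div_of_isLocallyConstant_cocycle`); iff form
  `galH1Map_eq_zero_iff_exists_torsorClass`.
* `eq_zero_of_mem_sha_of_galH1Map_eq_zero` — over a number field, a SHARP descent (every `a` with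
  `[C_a] ∈ Ш(W/K)` has `[a]` in a subgroup of `K*/K*³` on which `[C_·]` vanishes, e.g. the one generated
  by descent values of rational points) kills `Ш(W/K) ∩ ker f_*` — the tree's form of `Ш(W/K)[f] = 0`.
* `apply_T_eq_zero_of_fixed` — **the kernel point dies under an abstract dual**: if
  `ψ : W(K̄) → W'(K̄)` is `Γ_K`-equivariant, `ψ(T)` is `Γ_K`-fixed with `3 ψ(T) = O`, and `√−3 ∉ K`,
  then `ψ(T) = O` (`T` is moved to `−T` by some `σ₀`, its image is not moved, so `2ψ(T) = 0`); for the
  dual `ψ = φ̂` of a `3`-isogeny `φ : W' → W` with `K`-rational kernel, `φ(ψ T) = 3T = O` makes `ψ(T)`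
  a rational point. `ker_subset_of_natCard_le_three` — then `ker ψ ⊆ {O, ±T}` once `#ker ψ ≤ 3`
  (Cohen–Pazuki Prop. 1.4 (1): «the kernel of `φ̂` is `{Ô, ±T̂}`»), which is the hypothesis `hker` of
  the image theorem.

## References

* [SilvermanAEC2009] J. H. Silverman, *The Arithmetic of Elliptic Curves*, 2nd ed., GTM 106 (2009),
  Thm. X.4.2 (a), Prop. X.4.9, Thm. III.6.1–6.2 (dual isogeny).
* [CohenPazuki2009] H. Cohen, F. Pazuki, Acta Arith. 140 (2009), Prop. 1.4 (1) («the kernel of `φ̂` is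
  `{Ô, ±T̂}`»).
* [Serre1979] J.-P. Serre, *Local Fields*, Ch. X §1 (Hilbert 90).
* Template in the tree: `Literature.NumberTheory.EllipticCurves.MordellCurveThreeDescentImage`.
-/

noncomputable section

open scoped Classical

universe u

namespace Literature.NumberTheory.EllipticCurves

namespace MuThreeKernel

open WeierstrassCurve GaloisRepresentations MordellDescent

variable {K : Type u} [Field K] [CharZero K] {W W' : WeierstrassCurve K} (𝒯 : MuThreeKernel W)
  (f : geomPoints W →+ geomPoints W')
  (hf : ∀ (σ : Field.absoluteGaloisGroup K) (P : geomPoints W), f (σ • P) = σ • f P)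

/-! ## `f_* [C_a] = 0` when `f(T) = O` -/

/-- **`f_* [C_a] = 0` when `f(T) = O`**: the torsor cocycle takes values in `ℤ T ⊆ ker f`.
[cite: SilvermanAEC2009, Thm. X.4.2 (a)] -/
theorem galH1Map_torsorClass_eq_zero (hfT : f 𝒯.T = 0) {a : K} (ha : a ≠ 0) :
    galH1Map f hf (𝒯.torsorClass ha) = 0 := by
  rw [torsorClass, galH1Map_oneCocycleClass, oneCocycleClass_eq_zero_iff]
  refine ⟨0, fun σ => ?_⟩
  rw [contOneCocycles.push_apply, torsorCocycle_apply, torsorFun, chiT_eq_val_nsmul, map_nsmul, hfT,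
    nsmul_zero, discreteTopRep_ρ_apply, smul_zero, sub_zero]

/-- Hence `f_*` kills the whole image of `torsorClassQuotHom` when `f(T) = O`. [cite: SilvermanAEC2009, Thm. X.4.2 (a)] -/
theorem galH1Map_torsorClassQuotHom_eq_zero (hfT : f 𝒯.T = 0) (x : CubeUnits K) :
    galH1Map f hf (Multiplicative.toAdd (𝒯.torsorClassQuotHom x)) = 0 := by
  induction x using QuotientGroup.induction_on with
  | H u =>
    rw [torsorClassQuotHom_mk, toAdd_ofAdd]
    exact 𝒯.galH1Map_torsorClass_eq_zero f hf hfT u.ne_zero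

/-! ## The image theorem: `ker f_* ⊆ im [C_·]` -/

/-- **`ker f_* ⊆ im [C_·]`** — a class `c ∈ H¹(K, W)` killed by `f_*`, for a `Γ_K`-equivariant
surjection `f : W(K̄) → W'(K̄)` with `ker f ⊆ {O, ±T}`, is a torsor class `[C_a]`
(Silverman, *AEC*, Thm. X.4.2 (a): `H¹(G, E[φ]) = K*/K*³` maps onto `WC(E/K)[φ]`).
Proof: `f ∘ g = ∂(f P)` makes `g − ∂P` a cocycle `σ ↦ n(σ) T` with `n(στ) = n(σ) + ε(σ) n(τ)`;
Hilbert 90 for the locally constant `K̄*`-valued cocycle `ω^{n(σ)}` gives `β` with `σβ = ω^{n(σ)} β`,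
so `β³ = a ∈ K*`, `∛a = ω^j β`, `kummerExp a σ = n(σ) + (ε(σ) − 1) j`, and `[C_a] = [g − ∂P] + [∂(jT)] = c`.
[cite: SilvermanAEC2009, Thm. X.4.2 (a)] -/
theorem exists_torsorClass_eq_of_galH1Map_eq_zero (hsurj : Function.Surjective f)
    (hker : ∀ P : geomPoints W, f P = 0 → P = 0 ∨ P = 𝒯.T ∨ P = -𝒯.T)
    (c₀ : W.galH1) (hc₀ : galH1Map f hf c₀ = 0) :
    ∃ (a : K) (ha : a ≠ 0), 𝒯.torsorClass ha = c₀ := by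
  obtain ⟨g, rfl⟩ := oneCocycleClass_surjective _ c₀
  rw [galH1Map_oneCocycleClass, oneCocycleClass_eq_zero_iff] at hc₀
  obtain ⟨Q, hQ⟩ := hc₀
  obtain ⟨P, rfl⟩ := hsurj Q
  have hQ' : ∀ σ : Field.absoluteGaloisGroup K, f (g.1 σ) = σ • f P - f P := fun σ => hQ σ
  -- `g' = g - ∂P` takes values in `{O, ±T}`
  set g' := g - cobCocycle P (continuous_smul_geomPoints _ P) with hg'
  have hg'val : ∀ σ : Field.absoluteGaloisGroup K, g'.1 σ = g.1 σ - (σ • P - P) := fun σ => rfl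
  have hg'ker : ∀ σ : Field.absoluteGaloisGroup K,
      g'.1 σ = 0 ∨ g'.1 σ = 𝒯.T ∨ g'.1 σ = -𝒯.T := by
    intro σ
    apply hker
    rw [hg'val, map_sub, map_sub, hf, hQ', sub_self]
  have hclass : oneCocycleClass _ g' = oneCocycleClass _ g := by
    rw [hg', oneCocycleClass_sub, oneCocycleClass_cobCocycle, sub_zero]
  -- the exponent function `n : Γ_K → ℤ/3ℤ` with `g' σ = n(σ) T`
  choose n hn using fun σ => 𝒯.exists_chiT_eq (hg'ker σ)
  have hinj := 𝒯.chiT_injective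
  -- the twisted homomorphism identity `n(στ) = n(σ) + ε(σ) n(τ)`
  have hnmul : ∀ σ τ : Field.absoluteGaloisGroup K, n (σ * τ) = n σ + eps σ * n τ := by
    intro σ τ
    apply hinj
    rw [hn, map_add, ← smul_chiT, hn, hn]
    exact g'.2 σ τ
  -- the `μ₃`-valued cocycle `s(σ) = ω^{n(σ)}`
  set s : Field.absoluteGaloisGroup K → AlgebraicClosure K := fun σ => omega K ^ (n σ).val with hs
  have hs0 : ∀ σ, s σ ≠ 0 := fun σ => pow_ne_zero _ (omega_ne_zero K)
  have hslc : IsLocallyConstant s := by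
    have hglc : IsLocallyConstant g'.1 := (IsLocallyConstant.iff_continuous g'.1).mpr g'.1.continuous
    have hns : s = (fun x : geomPoints W =>
        omega K ^ (if h : ∃ m : ZMod 3, 𝒯.chiT m = x then (Classical.choose h).val else 0)) ∘ g'.1 := by
      funext σ
      simp only [Function.comp_apply, hs]
      have hex : ∃ m : ZMod 3, 𝒯.chiT m = g'.1 σ := ⟨n σ, hn σ⟩
      rw [dif_pos hex]
      congr 2
      exact (hinj ((Classical.choose_spec hex).trans (hn σ).symm)).symm
    rw [hns]
    exact hglc.comp _
  have hscoc : ∀ σ τ : Field.absoluteGaloisGroup K, s (σ * τ) = s σ * σ • s τ := by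
    intro σ τ
    change omega K ^ (n (σ * τ)).val = omega K ^ (n σ).val * galAut σ (omega K ^ (n τ).val)
    rw [galAut_omega_pow, ← pow_add, omega_pow_eq_pow_iff, hnmul]
    push_cast
    rw [ZMod.natCast_zmod_val, ZMod.natCast_zmod_val, ZMod.natCast_zmod_val, epsNat_cast]
  obtain ⟨β, hβ0, hβ⟩ :=
    absoluteGaloisGroup.exists_eq_smul_div_of_isLocallyConstant_cocycle K hslc hs0 hscoc
  have hσβ : ∀ σ : Field.absoluteGaloisGroup K, galAut σ β = s σ * β := by
    intro σ
    change σ • β = s σ * β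
    rw [hβ σ, div_mul_cancel₀ _ hβ0]
  have hs3 : ∀ σ, s σ ^ 3 = 1 := by
    intro σ
    change (omega K ^ (n σ).val) ^ 3 = 1
    rw [← pow_mul, mul_comm, pow_mul, omega_pow_three, one_pow]
  -- `β³ = a ∈ K`
  have hβ3 : ∀ σ : Field.absoluteGaloisGroup K, galAut σ (β ^ 3) = β ^ 3 := by
    intro σ
    rw [map_pow, hσβ, mul_pow, hs3, one_mul]
  obtain ⟨a, hda⟩ := exists_algebraMap_eq_of_forall_galAut hβ3
  have ha0 : a ≠ 0 := by
    rintro rfl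
    rw [map_zero, eq_comm] at hda
    exact pow_ne_zero 3 hβ0 hda
  -- `∛a = ω^j β`
  obtain ⟨j, -, hj⟩ : ∃ j < 3, omega K ^ j = cubeRoot a / β := by
    apply exists_pow_eq_of_pow_three_eq_one K
    rw [div_pow, cubeRoot_pow_three, hda, div_self (pow_ne_zero 3 hβ0)]
  have hroot : cubeRoot a = omega K ^ j * β := by
    rw [hj, div_mul_cancel₀ _ hβ0]
  -- `kummerExp a σ = n(σ) + (ε(σ) − 1) j`
  have hkum : ∀ σ : Field.absoluteGaloisGroup K, kummerExp a σ = n σ + (eps σ - 1) * j := by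
    intro σ
    have h : galAut σ (cubeRoot a) = omega K ^ (epsNat σ * j + (n σ).val + 2 * j) * cubeRoot a := by
      have hω3 := omega_pow_three K
      conv_lhs => rw [hroot, map_mul, galAut_omega_pow, hσβ]
      rw [hroot]
      change omega K ^ (epsNat σ * j) * (omega K ^ (n σ).val * β) =
        omega K ^ (epsNat σ * j + (n σ).val + 2 * j) * (omega K ^ j * β)
      have : omega K ^ (epsNat σ * j + (n σ).val + 2 * j) * (omega K ^ j * β) =
          omega K ^ (epsNat σ * j) * omega K ^ (n σ).val * (omega K ^ 3) ^ j * β := by ring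
      rw [this, hω3, one_pow, mul_one, mul_assoc]
    rw [kummerExp_eq_of_galAut_eq ha0 h]
    push_cast
    rw [epsNat_cast, ZMod.natCast_zmod_val]
    have h3 : (2 : ZMod 3) = -1 := by decide
    rw [h3]
    ring
  -- the torsor cocycle of `a` is `g' + ∂(jT)`
  refine ⟨a, ha0, ?_⟩
  rw [torsorClass, ← hclass, ← sub_eq_zero, ← oneCocycleClass_sub, oneCocycleClass_eq_zero_iff]
  refine ⟨𝒯.chiT (j : ZMod 3), fun σ => ?_⟩
  change 𝒯.torsorFun a σ - g'.1 σ = σ • 𝒯.chiT (j : ZMod 3) - 𝒯.chiT (j : ZMod 3)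
  rw [torsorFun, hkum, map_add, hn, chiT_eps_sub_one_mul, add_sub_cancel_left]

/-- **`ker f_* = im [C_·]`, elementwise**: under the hypotheses of the image theorem and `f(T) = O`,
a class of `H¹(K, W)` is killed by `f_*` iff it is a torsor class. [cite: SilvermanAEC2009, Thm. X.4.2 (a)] -/
theorem galH1Map_eq_zero_iff_exists_torsorClass (hsurj : Function.Surjective f)
    (hker : ∀ P : geomPoints W, f P = 0 → P = 0 ∨ P = 𝒯.T ∨ P = -𝒯.T)
    (hfT : f 𝒯.T = 0) (c₀ : W.galH1) :
    galH1Map f hf c₀ = 0 ↔ ∃ (a : K) (ha : a ≠ 0), 𝒯.torsorClass ha = c₀ := by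
  constructor
  · exact 𝒯.exists_torsorClass_eq_of_galH1Map_eq_zero f hf hsurj hker c₀
  · rintro ⟨a, ha, rfl⟩
    exact 𝒯.galH1Map_torsorClass_eq_zero f hf hfT ha

/-! ## Sharp descent kills `Ш ∩ ker f_*` -/

/-- **Sharp descent kills `Ш ∩ ker f_*`.** Over a number field: if every `a ∈ K*` whose torsor class
lies in `Ш(W/K)` has its class `[a] ∈ K*/K*³` in a subgroup `B` on which `[C_·]` vanishes — e.g. the
subgroup generated by the descent values of rational points, i.e. the `f`-Selmer group is filled by
rational points — then no non-zero class of `Ш(W/K)` is killed by `f_*`: `Ш(W/K) ∩ ker f_* = 0`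
(`Ш(W/K)[f] = 0`). [cite: SilvermanAEC2009, Thm. X.4.2 (a)] -/
theorem eq_zero_of_mem_sha_of_galH1Map_eq_zero [NumberField K] (hsurj : Function.Surjective f)
    (hker : ∀ P : geomPoints W, f P = 0 → P = 0 ∨ P = 𝒯.T ∨ P = -𝒯.T)
    (B : Subgroup (CubeUnits K)) (hB : B ≤ 𝒯.torsorClassQuotHom.ker)
    (hsharp : ∀ (a : K) (ha : a ≠ 0), 𝒯.torsorClass ha ∈ W.sha → cubeClass a ∈ B)
    {c₀ : W.galH1} (hsha : c₀ ∈ W.sha) (h0 : galH1Map f hf c₀ = 0) :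
    c₀ = 0 := by
  obtain ⟨a, ha, rfl⟩ := 𝒯.exists_torsorClass_eq_of_galH1Map_eq_zero f hf hsurj hker c₀ h0
  exact (𝒯.torsorClass_eq_zero_iff_cubeClass_mem_ker ha).mpr (hB (hsharp a ha hsha))

/-- The generating-set form: if `[C_·]` vanishes on a set `S ⊆ K*/K*³` (e.g. the classes of descent
values of rational points) and every `a` with `[C_a] ∈ Ш(W/K)` has `[a] ∈ ⟨S⟩`, then
`Ш(W/K) ∩ ker f_* = 0`. [cite: SilvermanAEC2009, Thm. X.4.2 (a)] -/
theorem eq_zero_of_mem_sha_of_galH1Map_eq_zero_of_closure [NumberField K]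
    (hsurj : Function.Surjective f)
    (hker : ∀ P : geomPoints W, f P = 0 → P = 0 ∨ P = 𝒯.T ∨ P = -𝒯.T)
    (S : Set (CubeUnits K)) (hS : ∀ x ∈ S, 𝒯.torsorClassQuotHom x = 1)
    (hsharp : ∀ (a : K) (ha : a ≠ 0), 𝒯.torsorClass ha ∈ W.sha → cubeClass a ∈ Subgroup.closure S)
    {c₀ : W.galH1} (hsha : c₀ ∈ W.sha) (h0 : galH1Map f hf c₀ = 0) :
    c₀ = 0 :=
  𝒯.eq_zero_of_mem_sha_of_galH1Map_eq_zero f hf hsurj hker (Subgroup.closure S)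
    ((Subgroup.closure_le _).mpr fun x hx => (MonoidHom.mem_ker).mpr (hS x hx)) hsharp hsha h0

/-! ## The kernel of an abstract dual -/

omit [CharZero K] in
/-- **A `Γ_K`-equivariant map kills `T` as soon as it sends `T` to a `Γ_K`-fixed point of order
dividing `3` and `√−3 ∉ K`**: with `σ₀√−3 = −√−3`, `ψ(T) = ψ(σ₀ T)·(−1)… ` precisely,
`σ₀ • ψ T = ψ (σ₀ • T) = ψ(−T) = −ψ T` and `σ₀ • ψ T = ψ T` give `2 ψ(T) = 0`, and with `3 ψ(T) = 0`
this forces `ψ(T) = 0`. Used for the abstract dual `ψ = φ̂` of a `3`-isogeny `φ : W' → W` with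
`K`-rational kernel: `φ (ψ T) = 3T = O`, so `ψ T ∈ ker φ` is rational.
[cite: CohenPazuki2009, Proposition 1.4 (1)] -/
theorem apply_T_eq_zero_of_fixed (ψ : geomPoints W →+ geomPoints W')
    (hψ : ∀ (σ : Field.absoluteGaloisGroup K) (P : geomPoints W), ψ (σ • P) = σ • ψ P)
    (hfix : ∀ σ : Field.absoluteGaloisGroup K, σ • ψ 𝒯.T = ψ 𝒯.T)
    (h3 : (3 : ℕ) • ψ 𝒯.T = 0)
    {σ₀ : Field.absoluteGaloisGroup K} (hσ₀ : galAut σ₀ (theta K) ≠ theta K) : ψ 𝒯.T = 0 := by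
  have h1 : ψ 𝒯.T = -ψ 𝒯.T := by
    have h := hfix σ₀
    rw [← hψ, 𝒯.smul_T σ₀, if_neg hσ₀, map_neg] at h
    exact h.symm
  have h2 : (2 : ℕ) • ψ 𝒯.T = 0 := by
    rw [two_nsmul]
    nth_rewrite 2 [h1]
    exact add_neg_cancel _
  have : ψ 𝒯.T = (3 : ℕ) • ψ 𝒯.T - (2 : ℕ) • ψ 𝒯.T := by
    rw [succ_nsmul, add_sub_cancel_left]
  rw [this, h3, h2, sub_zero]

omit [CharZero K] in
/-- **`ker ψ ⊆ {O, ±T}` for a homomorphism killing `T` whose kernel has at most `3` elements.**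
[cite: CohenPazuki2009, Proposition 1.4 (1)] -/
theorem ker_subset_of_natCard_le_three (ψ : geomPoints W →+ geomPoints W') (hψT : ψ 𝒯.T = 0)
    (hcard : Nat.card ψ.ker ≤ 3) [Finite ψ.ker] (P : geomPoints W) (hP : ψ P = 0) :
    P = 0 ∨ P = 𝒯.T ∨ P = -𝒯.T := by
  by_contra hne
  push Not at hne
  obtain ⟨h0, hT, hnT⟩ := hne
  -- the four elements `O, T, −T, P` of `ker ψ` are distinct
  have hmem : ∀ Q ∈ ({0, 𝒯.T, -𝒯.T, P} : Finset (geomPoints W)), Q ∈ ψ.ker := by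
    intro Q hQ
    simp only [Finset.mem_insert, Finset.mem_singleton] at hQ
    rcases hQ with rfl | rfl | rfl | rfl
    · exact ψ.ker.zero_mem
    · exact hψT
    · rw [AddMonoidHom.mem_ker, map_neg, hψT, neg_zero]
    · exact hP
  have hcard4 : ({0, 𝒯.T, -𝒯.T, P} : Finset (geomPoints W)).card = 4 := by
    have h1 := 𝒯.T_ne_zero
    have h2 := 𝒯.T_ne_neg
    have h3 : -𝒯.T ≠ 0 := neg_ne_zero.mpr h1
    rw [Finset.card_insert_of_notMem, Finset.card_insert_of_notMem, Finset.card_pair]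
    · exact fun h => hnT (h ▸ rfl) |>.elim
    · simp only [Finset.mem_insert, Finset.mem_singleton, not_or]
      exact ⟨h2, fun h => hT h.symm⟩
    · simp only [Finset.mem_insert, Finset.mem_singleton, not_or]
      exact ⟨h1.symm, h3.symm, fun h => h0 h.symm⟩
  have hle : 4 ≤ Nat.card ψ.ker := by
    let ι : ({0, 𝒯.T, -𝒯.T, P} : Finset (geomPoints W)) → ψ.ker := fun Q => ⟨Q.1, hmem Q.1 Q.2⟩
    have hι : Function.Injective ι := fun Q₁ Q₂ h => Subtype.ext (congrArg (fun x : ψ.ker => (x : geomPoints W)) h)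
    have := Nat.card_le_card_of_injective ι hι
    rwa [Nat.card_eq_fintype_card, Fintype.card_coe, hcard4] at this
  omega

end MuThreeKernel

end Literature.NumberTheory.EllipticCurves

end
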